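import Literature.Topology.FourManifolds.TautFoliationsFenceRelevel
import Literature.Topology.PlanarFoliations.NullTransport
import HarnessLib

/-!
# Transport of null-homotopy along a closed fence in `M`

Topic: codimension-one `C⁰` foliations, the transport of null-homotopy of the closed
horizontals of a fence to nearby levels (Camacho–Lins Neto, *Geometric Theory of Foliations*,
Ch. IV §2 Lemma 4 / Ch. VII §2: "if `γ_t` is homotopic to a constant in `A_t` then so is
`γ_{t'}` for `t'` near `t`"), here **inside the foliated manifold itself** (the planar,
foliated-map version is `PlanarFoliations.NullTransport`). Let `Φ` be a fence over the unit
interval at the level `τ₀` for a germ family `Γ` whose initial germ is the height germ of a flow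
box `e₀` at a point of height `τ₀`; its horizontal `h_τ = Φ(·, τ)` is a leafwise path, a loop
when `Φ 1 τ = Φ 0 τ` ("closed level"). **If the horizontal loop at a closed level `τ₁` close to
`τ₀` is null-homotopic in the leaf topology, so are the horizontal loops at all closed levels
near `τ₁`** (`IsFenceOn.exists_forall_nullLevel`). Proof: re-base the fence at `τ₁`
(`IsFenceOn.exists_relevel`), then the square argument of `PlanarFoliations.NullTransport` with
the identity as foliated map: the null-homotopy gives a leaf map of a square equal to `h_{τ₁}` on
one edge and constant on the other three; its germ lift carries a fence extending the re-based
fence near that edge; the three constant edges lie in one plaque of `e₀` at every nearby level,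
so the horizontal loop at a nearby closed level is homotopic to a loop in one plaque, which is
null-homotopic.

* `IsFenceOn.horiz`, `IsFenceOn.NullLevel` (**definitions**), `IsFenceOn.exists_forall_nullLevel`
  (**proved**).
-/

noncomputable section

open Set Filter Function
open scoped Topology unitInterval
open Literature.Topology.PlanarFoliations

namespace Literature.Topology.FourManifolds

namespace Foliation

variable {B : Type*} [NormedAddCommGroup B] [NormedSpace ℝ B] [LocallyConnectedSpace B]
  {M : Type*} [TopologicalSpace M] {F : Foliation B M}
variable {Γ : C(I, F.GermSpace)} {τ₀ ε : ℝ} {Φ : I → ℝ → M}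

namespace IsFenceOn

/-- The horizontal of a fence over the unit interval at an admissible level, as a continuous
map into the leaf space. [folklore] -/
def horiz (hΦ : IsFenceOn F Γ τ₀ ε Φ univ) (τ : ℝ) (hτ : τ ∈ Ioo (τ₀ - ε) (τ₀ + ε)) : C(I, F.LeafSpace) :=
  ⟨toLeafSpace ∘ fun θ ↦ Φ θ τ, hΦ.continuous_toLeafSpace hτ⟩

omit [NormedSpace ℝ B] [LocallyConnectedSpace B] in
/-- Value of the horizontal. [folklore] -/
@[simp] theorem horiz_apply (hΦ : IsFenceOn F Γ τ₀ ε Φ univ) {τ : ℝ} (hτ : τ ∈ Ioo (τ₀ - ε) (τ₀ + ε)) (θ : I) :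
    hΦ.horiz τ hτ θ = toLeafSpace (Φ θ τ) := rfl

/-- The horizontal loop at a closed admissible level. [folklore] -/
def horizLoop (hΦ : IsFenceOn F Γ τ₀ ε Φ univ) (τ : ℝ) (hτ : τ ∈ Ioo (τ₀ - ε) (τ₀ + ε)) (hcl : Φ 1 τ = Φ 0 τ) :
    Path (toLeafSpace (Φ 0 τ) : F.LeafSpace) (toLeafSpace (Φ 0 τ)) where
  toFun := hΦ.horiz τ hτ
  continuous_toFun := (hΦ.horiz τ hτ).continuous
  source' := rfl
  target' := congrArg toLeafSpace hcl

omit [NormedSpace ℝ B] [LocallyConnectedSpace B] in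
/-- Value of the horizontal loop. [folklore] -/
@[simp] theorem horizLoop_apply (hΦ : IsFenceOn F Γ τ₀ ε Φ univ) {τ : ℝ} (hτ : τ ∈ Ioo (τ₀ - ε) (τ₀ + ε))
    (hcl : Φ 1 τ = Φ 0 τ) (θ : I) : hΦ.horizLoop τ hτ hcl θ = toLeafSpace (Φ θ τ) := rfl

/-- **A null level** of the fence: an admissible closed level whose horizontal loop is
null-homotopic in the leaf topology. [folklore] -/
def NullLevel (hΦ : IsFenceOn F Γ τ₀ ε Φ univ) (τ : ℝ) : Prop :=
  ∃ (hτ : τ ∈ Ioo (τ₀ - ε) (τ₀ + ε)) (hcl : Φ 1 τ = Φ 0 τ), (hΦ.horizLoop τ hτ hcl).Homotopic (Path.refl _)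

/-- **The transport theorem at the base level.** If the initial germ of the fence is the height
germ of `e₀` at a point of the plaque of height `τ₀`, and the base level is a null level, then
all closed levels near the base level are null levels. [cite: CamachoLinsNeto1985, Ch. IV §2 Lemma 4] -/
theorem exists_forall_nullLevel_base [Nonempty B] (hΦ : IsFenceOn F Γ τ₀ ε Φ univ) (hε : 0 < ε)
    {e₀ : OpenPartialHomeomorph M (B × ℝ)} (he₀ : e₀ ∈ F.atlas) (hΓ₀ : (Γ 0).germ = ↑(height e₀))
    (hpt₀ : ofLeafSpace (Γ 0).pt ∈ plaque e₀ τ₀) (hnull : hΦ.NullLevel τ₀) :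
    ∃ δ > (0 : ℝ), δ ≤ ε ∧ ∀ τ ∈ Ioo (τ₀ - δ) (τ₀ + δ), Φ 1 τ = Φ 0 τ → hΦ.NullLevel τ := by
  obtain ⟨hτ₀, hcl₀, ⟨H⟩⟩ := hnull
  set q₀ : F.LeafSpace := toLeafSpace (Φ 0 τ₀) with hq₀
  -- the leaf map of the square: the horizontal loop on the lower half, the null-homotopy above
  set gf : Sq → F.LeafSpace := fun a ↦ H (projIcc 0 1 zero_le_one (2 * (a : ℝ × ℝ).1 - 1), θSq a) with hgf
  have hgc : Continuous gf := by
    refine H.continuous.comp (Continuous.prodMk ?_ continuous_θSq)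
    exact continuous_projIcc.comp ((continuous_const.mul (continuous_fst.comp continuous_subtype_val)).sub continuous_const)
  set g : C(Sq, F.LeafSpace) := ⟨gf, hgc⟩ with hgdef
  have hg_low : ∀ a : Sq, (a : ℝ × ℝ).1 ≤ 1 / 2 → g a = toLeafSpace (Φ (θSq a) τ₀) := by
    intro a ha
    show H (projIcc 0 1 zero_le_one (2 * (a : ℝ × ℝ).1 - 1), θSq a) = _
    rw [projIcc_of_le_left _ (by linarith), show (⟨0, left_mem_Icc.2 zero_le_one⟩ : I) = 0 from rfl, H.apply_zero]
    rfl
  have hg_edge : ∀ a ∈ edgeSet, g a = q₀ := by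
    intro a ha
    show H (projIcc 0 1 zero_le_one (2 * (a : ℝ × ℝ).1 - 1), θSq a) = q₀
    rcases ha with h | h | h
    · have hθ : θSq a = 0 := Subtype.ext h
      rw [hθ, H.eq_fst _ (by simp)]
      rfl
    · rw [h, show (2 : ℝ) * 1 - 1 = 1 by norm_num, projIcc_right, show (⟨1, right_mem_Icc.2 zero_le_one⟩ : I) = 1 from rfl,
        H.apply_one]
      rfl
    · have hθ : θSq a = 1 := Subtype.ext h
      rw [hθ, H.eq_fst _ (by simp)]
      show (hΦ.horizLoop τ₀ hτ₀ hcl₀) 1 = q₀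
      rw [Path.target]
  -- the lift `G` of `g` from the initial germ `d₀ = Γ 0`
  set d₀ : F.GermSpace := Γ 0 with hd₀def
  have hbase0 : Φ 0 τ₀ = ofLeafSpace (Γ 0).pt := hΦ.base 0 (mem_univ 0)
  have hd₀ : d₀.proj = g (mkSq 0 0) := by
    rw [hg_low _ (by show ((0 : I) : ℝ) ≤ 1 / 2; norm_num), θSq_mkSq]
    show (Γ 0).pt = toLeafSpace (Φ 0 τ₀)
    rw [hbase0]
    rfl
  obtain ⟨G, ⟨hG₀, hGg⟩, -⟩ := (F.isCoveringMap_proj).existsUnique_continuousMap_lifts g (mkSq 0 0) d₀ hd₀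
  have hGproj : ∀ a, (G a).proj = g a := fun a ↦ congr_fun hGg a
  -- levels
  have hlev0 : GermSpace.level d₀ = τ₀ := by
    show (Γ 0).germ.value = τ₀
    rw [hΓ₀, Germ.value_ofFun]
    exact hpt₀.2
  have hlev : ∀ a, GermSpace.level (G a) = τ₀ := fun a ↦ by
    rw [F.level_apply_eq_of_preconnectedSpace G a (mkSq 0 0), hG₀, hlev0]
  -- the fence over `I`, pulled back to the square
  have hP₂ : IsFenceOn F (Γ ∘ θSq) τ₀ ε (fun a τ ↦ Φ (θSq a) τ) univ := hΦ.comp_right continuous_θSq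
  -- `G` agrees with `Γ ∘ θSq` on the lower half `S₀`
  set S₀ : Set Sq := {a | (a : ℝ × ℝ).1 < 1 / 2} with hS₀def
  have hS₀o : IsOpen S₀ := isOpen_lt (continuous_fst.comp continuous_subtype_val) continuous_const
  have ha₀S₀ : mkSq 0 0 ∈ S₀ := by show ((0 : I) : ℝ) < 1 / 2; norm_num
  have hS₀pre : IsPreconnected S₀ := by
    rw [← Topology.IsInducing.subtypeVal.isPreconnected_image]
    have hconv : Convex ℝ (Subtype.val '' S₀) := by
      have heq : Subtype.val '' S₀ = sqSet ∩ {p : ℝ × ℝ | p.1 < 1 / 2} := by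
        ext p
        constructor
        · rintro ⟨a, ha, rfl⟩
          exact ⟨a.2, ha⟩
        · rintro ⟨hp, hp'⟩
          exact ⟨⟨p, hp⟩, hp', rfl⟩
      rw [heq]
      exact convex_sqSet.inter (convex_halfSpace_lt (LinearMap.fst ℝ ℝ ℝ).isLinear _)
    exact hconv.isPreconnected
  set G' : C(Sq, F.GermSpace) := ⟨fun a ↦ Γ (θSq a), Γ.continuous.comp continuous_θSq⟩ with hG'def
  have hGeq : ∀ a ∈ S₀, G a = G' a := by
    intro a ha
    refine apply_eq_of_proj_eq G G' hS₀pre (fun a' ha' ↦ ?_) ha₀S₀ ?_ ha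
    · rw [hGproj, hg_low a' (le_of_lt ha')]
      show toLeafSpace (Φ (θSq a') τ₀) = (Γ (θSq a')).pt
      rw [hΦ.base (θSq a') (mem_univ _)]
      rfl
    · rw [hG₀]
      rfl
  -- the initial fence over `S₀`
  have h₀ : IsFenceOn F G τ₀ ε (fun a τ ↦ Φ (θSq a) τ) S₀ :=
    (hP₂.mono (subset_univ S₀) le_rfl).congr_germ fun a ha ↦ hGeq a ha
  -- relative extension over the whole square, unchanged near the edge `t = 0`
  set K₀ : Set Sq := {a | (a : ℝ × ℝ).1 ≤ 1 / 4} with hK₀def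
  have hK₀c : IsCompact K₀ := (isClosed_le (continuous_fst.comp continuous_subtype_val) continuous_const).isCompact
  have hK₀S₀ : K₀ ⊆ S₀ := fun a ha ↦ by show (a : ℝ × ℝ).1 < 1 / 2; exact lt_of_le_of_lt ha (by norm_num)
  obtain ⟨ε₁, hε₁, Ψ, hΨ, V, hVo, hK₀V, hΨeq⟩ := exists_isFenceOn_univ_of_isFenceOn G hlev hε h₀ hS₀o hK₀c hK₀S₀
  -- the edge datum: the box `e₀` with identity functions, on `U = {G = d₀}`
  set U : Set Sq := {a | G a = d₀} with hUdef
  let D : LocalDatum F G τ₀ ε U :=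
    { box := e₀
      box_mem := he₀
      φ := id
      ψ := id
      germ_eq := fun a ha ↦ by rw [show G a = d₀ from ha]; exact hΓ₀
      pt_mem := fun a ha ↦ by rw [show G a = d₀ from ha]; exact hpt₀
      φ_ψ := fun τ _ ↦ rfl
      ψ_φ := Eventually.of_forall fun _ ↦ rfl
      ψ_cont := continuousOn_id
      ψ_inj := injOn_id _ }
  -- the three edges lie in `U`: `G` is constant there, lying over the constant `q₀`
  have hEU : range edge₃ ⊆ U := by
    intro a ha
    have hq : ∀ a' ∈ range edge₃, (G a').proj = q₀ := fun a' ha' ↦ by rw [hGproj, hg_edge a' (range_edge₃_subset ha')]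
    have hcorner : mkSq 0 0 ∈ range edge₃ := ⟨0, edge₃.source⟩
    show G a = d₀
    rw [apply_eq_of_proj_eq_const G isPreconnected_edgeSet_range hq ha hcorner, hG₀]
  obtain ⟨δE, hδE, hδEε₁, hlevE⟩ := hΨ.exists_forall_level isOpen_univ hε₁ D (isCompact_range edge₃.continuous)
    (subset_univ _) hEU
  -- the level radius
  set δ : ℝ := min δE ε with hδdef
  have hδ : 0 < δ := lt_min hδE hε
  refine ⟨δ, hδ, min_le_right _ _, fun τ hτ hcl ↦ ?_⟩
  have hτE : τ ∈ Ioo (τ₀ - δE) (τ₀ + δE) := Ioo_subset_Ioo (by linarith [min_le_left δE ε]) (by linarith [min_le_left δE ε]) hτ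
  have hτε₁ : τ ∈ Ioo (τ₀ - ε₁) (τ₀ + ε₁) := Ioo_subset_Ioo (by linarith) (by linarith) hτE
  have hτε : τ ∈ Ioo (τ₀ - ε) (τ₀ + ε) := Ioo_subset_Ioo (by linarith [min_le_right δE ε]) (by linarith [min_le_right δE ε]) hτ
  refine ⟨hτε, hcl, ?_⟩
  -- the leaf map of level `τ` from the square
  set Ψτ : C(Sq, F.LeafSpace) := ⟨fun a ↦ toLeafSpace (Ψ a τ), hΨ.continuous_toLeafSpace hτε₁⟩ with hΨτ
  -- along the edge `t = 0` it is `h_τ`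
  have hbot : ∀ θ : I, Ψτ (mkSq 0 θ) = toLeafSpace (Φ θ τ) := fun θ ↦ by
    show toLeafSpace (Ψ (mkSq 0 θ) τ) = toLeafSpace (Φ θ τ)
    rw [hΨeq _ (hK₀V (by show ((0 : I) : ℝ) ≤ 1 / 4; norm_num)) τ hτε₁, θSq_mkSq]
  have hx : (toLeafSpace (Φ 0 τ) : F.LeafSpace) = Ψτ (mkSq 0 0) := (hbot 0).symm
  have hy : (toLeafSpace (Φ 0 τ) : F.LeafSpace) = Ψτ (mkSq 0 1) := by rw [hbot, hcl]
  have h₁ : hΦ.horizLoop τ hτε hcl = (edge₀.map Ψτ.continuous).cast hx hy := by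
    ext θ
    rw [Path.cast_coe, Path.map_coe, comp_apply, horizLoop_apply, edge₀_apply, hbot]
  -- the edge `t = 0` is homotopic to the three-edge path, mapped by `Ψτ`
  have h₂ : ((edge₀.map Ψτ.continuous).cast hx hy).Homotopic ((edge₃.map Ψτ.continuous).cast hx hy) :=
    homotopic_edge₀_edge₃.map Ψτ
  -- the three-edge path runs in one plaque
  have h₃ : ((edge₃.map Ψτ.continuous).cast hx hy).Homotopic (Path.refl _) := by
    refine F.homotopic_refl_of_forall_mem_plaque he₀ (t := τ) _ fun s ↦ ?_
    show Ψ (edge₃ s) τ ∈ plaque e₀ τ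
    exact hlevE (edge₃ s) ⟨s, rfl⟩ τ hτE
  rw [h₁]
  exact h₂.trans h₃

/-- **Transport of null-homotopy along a closed fence in `M`.** If the initial germ of the fence
is the height germ of a flow box `e₀` and the vertical of the fence at `0` has `e₀`-height equal
to the level, then for every null level `τ₁` close to the base level, all closed levels near
`τ₁` are null levels. [cite: CamachoLinsNeto1985, Ch. IV §2 Lemma 4] -/
theorem exists_forall_nullLevel [Nonempty B] (hΦ : IsFenceOn F Γ τ₀ ε Φ univ) (hε : 0 < ε)
    {e₀ : OpenPartialHomeomorph M (B × ℝ)} (he₀ : e₀ ∈ F.atlas) (hΓ₀ : (Γ 0).germ = ↑(height e₀))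
    (hvert : ∀ τ ∈ Ioo (τ₀ - ε) (τ₀ + ε), Φ 0 τ ∈ plaque e₀ τ) :
    ∃ η > (0 : ℝ), η ≤ ε ∧ ∀ τ₁ ∈ Ioo (τ₀ - η) (τ₀ + η), hΦ.NullLevel τ₁ →
      ∃ δ > (0 : ℝ), ∀ τ ∈ Ioo (τ₁ - δ) (τ₁ + δ), Φ 1 τ = Φ 0 τ → hΦ.NullLevel τ := by
  obtain ⟨η, hη, hηε, hrel⟩ := hΦ.exists_relevel hε (a₀ := 0) hΓ₀
  refine ⟨η, hη, hηε, fun τ₁ hτ₁ hnull ↦ ?_⟩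
  obtain ⟨Γ₁, hpt, hgerm, hΦ₁⟩ := hrel τ₁ hτ₁
  have hτ₁ε : τ₁ ∈ Ioo (τ₀ - ε) (τ₀ + ε) := ⟨by linarith [hτ₁.1], by linarith [hτ₁.2]⟩
  have hε₁ : 0 < ε - |τ₁ - τ₀| := by
    rcases le_or_gt 0 (τ₁ - τ₀) with h0 | h0
    · rw [abs_of_nonneg h0]; linarith [hτ₁.2]
    · rw [abs_of_neg h0]; linarith [hτ₁.1]
  have hI : Ioo (τ₁ - (ε - |τ₁ - τ₀|)) (τ₁ + (ε - |τ₁ - τ₀|)) ⊆ Ioo (τ₀ - ε) (τ₀ + ε) := by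
    intro τ hτ
    rcases le_or_gt 0 (τ₁ - τ₀) with h0 | h0
    · rw [abs_of_nonneg h0] at hτ
      constructor <;> linarith [hτ.1, hτ.2]
    · rw [abs_of_neg h0] at hτ
      constructor <;> linarith [hτ.1, hτ.2]
  -- null levels of the re-based fence are null levels of the fence (same horizontals)
  have hiff : ∀ τ (hτ₁' : τ ∈ Ioo (τ₁ - (ε - |τ₁ - τ₀|)) (τ₁ + (ε - |τ₁ - τ₀|))) (hcl : Φ 1 τ = Φ 0 τ),
      (hΦ₁.horizLoop τ hτ₁' hcl).Homotopic (Path.refl _) ↔ (hΦ.horizLoop τ (hI hτ₁') hcl).Homotopic (Path.refl _) := by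
    intro τ hτ₁' hcl
    have heq : hΦ₁.horizLoop τ hτ₁' hcl = hΦ.horizLoop τ (hI hτ₁') hcl := by ext θ; rfl
    rw [heq]
  have hpt₀ : ofLeafSpace (Γ₁ 0).pt ∈ plaque e₀ τ₁ := by
    rw [hpt 0]
    exact hvert τ₁ hτ₁ε
  obtain ⟨hτ₁'', hcl₁, hhom⟩ := hnull
  have hnull₁ : hΦ₁.NullLevel τ₁ := ⟨⟨by linarith, by linarith⟩, hcl₁, (hiff τ₁ ⟨by linarith, by linarith⟩ hcl₁).2 hhom⟩
  obtain ⟨δ, hδ, hδε, hall⟩ := hΦ₁.exists_forall_nullLevel_base hε₁ he₀ hgerm hpt₀ hnull₁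
  refine ⟨δ, hδ, fun τ hτ hcl ↦ ?_⟩
  obtain ⟨hτ', hcl', hhom'⟩ := hall τ hτ hcl
  exact ⟨hI hτ', hcl', (hiff τ hτ' hcl').1 hhom'⟩

end IsFenceOn

end Foliation

end Literature.Topology.FourManifolds
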